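import Summits.NavierStokesRegularity.NavierStokesRegularity.Theses.AxisymmetricExtremality
import Summits.NavierStokesRegularity.NavierStokesRegularity.Theorems.AxisymmetricExtremalityPFoldToAxisymmetric
import Summits.NavierStokesRegularity.NavierStokesRegularity.Theorems.AxisymmetricExtremalityMinimalDatumPFoldOfSymmGap

/-!
# Crux-triage r1 / triager 1 — certificates for `MinimalDatumPFold` (stmt-NavierStokesRegularity-15452)

§A  COSTUME CERTIFICATE for cards `large-p-collapse` and `dissipation-divergence-radius`.
    Their common transfer target `AxisymGapClosing` (C⁺; copied VERBATIM from
    `Cruxes/MinimalDatumPFold/SketchIdeator2.lean`) is ALREADY equivalent to the crux over the tree,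
    WITHOUT either card's lever (`AngularBesovCollapse` / `PFoldInfimumCollapse` / dissipation
    profiles): `axisymGapClosing_iff_minimalDatumPFold`.
    (→) trivial direction + the landed reduction `minimalDatumPFold_of_symmGapClosing` (p152445);
    (←) the PROVED sibling crux `axisymmetricExtremality_pFoldToAxisymmetric_proof` + "an
    axisymmetric minimal datum is a cheap a.e.-axisymmetric blow-up datum for every ε > 0".
    Hence the levers are idle for the crux: a line built on either card has residual ⇔ crux.
§B  TOY against the lever of `subthreshold-dissipation-branch` (its K3: "the maximiser branch can
    leave the symmetric class only at an amplitude where a transversal Hessian block degenerates"):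
    a reflection-invariant amplitude family on five points whose symmetric point is a STRICT
    (non-degenerate) local maximiser at every amplitude while the GLOBAL maximiser jumps to the free
    orbit — local equivariant-bifurcation bookkeeping does not control a supremum such as
    `A(ρ) = sup {Σ(u₀) : ‖u₀‖ ≤ ρ}`. `decide`.
-/

set_option linter.dupNamespace false

noncomputable section

namespace Summit.NavierStokesRegularity.NavierStokesRegularity.Cruxes.MinimalDatumPFold.TriageR1K1

open MeasureTheory Set Function Filter Topology
open scoped ENNReal NNReal
open Literature.Analysis.FluidPDE Literature.Analysis.FunctionSpaces
open Summit.NavierStokesRegularity.NavierStokesRegularity.Theses.AxisymmetricExtremality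
open Summit.NavierStokesRegularity.NavierStokesRegularity.Theorems

local notation "ℝ³" => EuclideanSpace ℝ (Fin 3)
local notation "ℂ³" => EuclideanSpace ℂ (Fin 3)

/-! ## §A  `AxisymGapClosing ↔ MinimalDatumPFold` over the tree (no collapse lemma, no dissipation) -/

/-- The rotation `R_θ` about the `x₂`-axis, written out as in the route file. -/
def rot (θ : ℝ) (x : ℝ³) : ℝ³ :=
  WithLp.toLp 2 ![Real.cos θ * x 0 - Real.sin θ * x 1, Real.sin θ * x 0 + Real.cos θ * x 1, x 2]

/-- Clay (A) fails at viscosity `ν` (verbatim the antecedent of the crux). -/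
def ClayFails (ν : ℝ) : Prop :=
  ∃ v₀ : ℝ³ → ℝ³, ContDiff ℝ (⊤ : ℕ∞) v₀ ∧ NSWave0.IsDivFree v₀ ∧ HasRapidSpatialDecay v₀ ∧
    ¬ ∃ (u : ℝ → ℝ³ → ℝ³) (p : ℝ → ℝ³ → ℝ), IsSmoothOnHalfSpace u ∧ IsSmoothOnHalfSpace p ∧
      IsNavierStokesSolution ν 0 v₀ u p ∧ HasBoundedEnergy u

/-- A blow-up datum (verbatim from SketchIdeator2). -/
def IsBlowupDatum (ν : ℝ) (u₀ : ℝ³ → ℝ³) (g : HomSobolev ℝ³ ℂ³ (1 / 2 : ℝ)) : Prop :=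
  MemLp u₀ 3 (volume : Measure ℝ³) ∧ g.Represents (EuclideanSpace.complexify ∘ u₀) ∧
    IsWeaklyDivFree u₀ ∧ ¬ HasGlobalKatoSolution ν u₀

/-- a.e. equivariance under `R_{2π/p}` (verbatim from SketchIdeator2). -/
def IsAePFold (p : ℕ) (u₀ : ℝ³ → ℝ³) : Prop :=
  ∀ᵐ x ∂(volume : Measure ℝ³), u₀ (rot (2 * Real.pi / p) x) = rot (2 * Real.pi / p) (u₀ x)

/-- a.e. axisymmetry (verbatim from SketchIdeator2). -/
def IsAeAxisym (u₀ : ℝ³ → ℝ³) : Prop :=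
  ∀ θ : ℝ, ∀ᵐ x ∂(volume : Measure ℝ³), u₀ (rot θ x) = rot θ (u₀ x)

/-- C⁺ of card `large-p-collapse` (= the target of `dissipation-divergence-radius` via its own
Transfer `AxisymDissipationUnbounded ⟺ AxisymGapClosing`), verbatim from SketchIdeator2. -/
def AxisymGapClosing : Prop :=
  ∀ ν : ℝ, 0 < ν → ClayFails ν → ∀ ε : ℝ≥0∞, 0 < ε →
    ∃ (u₀ : ℝ³ → ℝ³) (g : HomSobolev ℝ³ ℂ³ (1 / 2 : ℝ)),
      IsBlowupDatum ν u₀ g ∧ ‖g‖ₑ < rusinSverakRhoMaxPure ν + ε ∧ IsAeAxisym u₀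

/-- The registered open stub of line `symmetric-gap`, verbatim from SketchIdeator2. -/
def SymmGapClosing : Prop :=
  ∀ ν : ℝ, 0 < ν → ClayFails ν → ∀ N : ℕ, ∃ p : ℕ, N ≤ p ∧ 2 ≤ p ∧ ∀ ε : ℝ≥0∞, 0 < ε →
    ∃ (u₀ : ℝ³ → ℝ³) (g : HomSobolev ℝ³ ℂ³ (1 / 2 : ℝ)),
      MemLp u₀ 3 (volume : Measure ℝ³) ∧ g.Represents (EuclideanSpace.complexify ∘ u₀) ∧
      IsWeaklyDivFree u₀ ∧ ¬ HasGlobalKatoSolution ν u₀ ∧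
      ‖g‖ₑ < rusinSverakRhoMaxPure ν + ε ∧ IsAePFold p u₀

/-- Trivial direction (as in the card). -/
theorem symmGapClosing_of_axisymGapClosing (h : AxisymGapClosing) : SymmGapClosing := by
  intro ν hν hclay N
  refine ⟨max N 2, le_max_left _ _, le_max_right _ _, fun ε hε => ?_⟩
  obtain ⟨u₀, g, ⟨h3, hrep, hdiv, hns⟩, hlt, hax⟩ := h ν hν hclay ε hε
  exact ⟨u₀, g, h3, hrep, hdiv, hns, hlt, hax _⟩

/-- C⁺ ⇒ crux BY NAME, via the landed p152445 (as in the card). -/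
theorem minimalDatumPFold_of_axisymGapClosing (h : AxisymGapClosing) : MinimalDatumPFold :=
  minimalDatumPFold_of_symmGapClosing (symmGapClosing_of_axisymGapClosing h)

/-- **crux ⇒ C⁺ WITHOUT any collapse lemma**: the proved sibling crux `PFoldToAxisymmetric`
turns the crux's output into an axisymmetric MINIMAL datum, which is a cheap a.e.-axisymmetric
blow-up datum for every `ε > 0`. [folklore] -/
theorem axisymGapClosing_of_minimalDatumPFold (h : MinimalDatumPFold) : AxisymGapClosing := by
  intro ν hν hclay ε hε
  obtain ⟨u₀, g, hmin, hax⟩ :=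
    axisymmetricExtremality_pFoldToAxisymmetric_proof ν hν (h ν hν hclay)
  obtain ⟨h3, hrep, hdiv, hnorm, hns⟩ := hmin
  have hfin : rusinSverakRhoMaxPure ν ≠ ⊤ := by rw [← hnorm]; exact enorm_ne_top
  refine ⟨u₀, g, ⟨h3, hrep, hdiv, hns⟩, ?_, fun θ => Filter.Eventually.of_forall fun x => hax θ x⟩
  rw [hnorm]
  exact ENNReal.lt_add_right hfin hε.ne'

/-- **Costume certificate.** `AxisymGapClosing ↔ MinimalDatumPFold` over the tree: the re-cut
proposed by `large-p-collapse` (and adopted by `dissipation-divergence-radius`) is the crux itself;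
`AngularBesovCollapse` / `PFoldInfimumCollapse` are not needed for, and add nothing to, this
equivalence. [folklore] -/
theorem axisymGapClosing_iff_minimalDatumPFold : AxisymGapClosing ↔ MinimalDatumPFold :=
  ⟨minimalDatumPFold_of_axisymGapClosing, axisymGapClosing_of_minimalDatumPFold⟩

/-- And `SymmGapClosing ↔ MinimalDatumPFold ↔ AxisymGapClosing`: all three coincide over the tree
(the "p carries no slack" conclusion of `large-p-collapse` is already a theorem by compactness). -/
theorem symmGapClosing_iff_axisymGapClosing : SymmGapClosing ↔ AxisymGapClosing :=
  ⟨fun h => axisymGapClosing_of_minimalDatumPFold (minimalDatumPFold_of_symmGapClosing h),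
   symmGapClosing_of_axisymGapClosing⟩

/-! ## §B  Toy: non-degenerate symmetric branch, yet the global maximiser jumps -/

/-- Amplitude family on `Fin 5` with the reflection `Fin.rev` (fixed point `2`):
values `[ρ, 0, 1, 0, ρ]`. -/
def toyF (ρ : ℕ) (i : Fin 5) : ℕ := ![ρ, 0, 1, 0, ρ] i

/-- For every amplitude the family is reflection-invariant and the fixed point `2` is a STRICT local
maximiser (discrete Hessian `-1` in both directions, never degenerate); at amplitude `0` the global
maximum sits at the fixed point, at amplitude `2` it is attained ONLY on the free orbit `{0, 4}`.
So "no transversal degeneracy along the symmetric branch" (K3) does not keep the ARGMAX of a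
supremum symmetric: the card's inference K2 ∧ K3 ⇒ `AxisymSubthresholdSizeUnbounded` has a gap
(the "jump to a distant branch" its own RESULT paragraph concedes), and closing it requires
`A_ax(ρ) = A(ρ)` near `ρ_max` — a strengthening of the residual (⇔ AXB) itself. -/
theorem toy_jump :
    (∀ ρ : Fin 4, ∀ i : Fin 5, toyF ρ (Fin.rev i) = toyF ρ i) ∧
    (∀ ρ : Fin 4, toyF ρ 1 < toyF ρ 2 ∧ toyF ρ 3 < toyF ρ 2) ∧
    (∀ i : Fin 5, toyF 0 i ≤ toyF 0 2) ∧
    (∀ i : Fin 5, (∀ j : Fin 5, toyF 2 j ≤ toyF 2 i) → i ≠ 2) ∧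
    (∀ j : Fin 5, toyF 2 j ≤ toyF 2 0) := by
  decide

end Summit.NavierStokesRegularity.NavierStokesRegularity.Cruxes.MinimalDatumPFold.TriageR1K1

end
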